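import Summits.BirchSwinnertonDyer.BirchSwinnertonDyer.Theorems.ResidualThetaTransportAtTwoThetaTransportResidualCharpoly
import Literature.NumberTheory.EllipticCurves.SupersingularModPDecompositionImage
import Literature.NumberTheory.EllipticCurves.IsogenyFrobeniusTraceProofs
import Literature.NumberTheory.EllipticCurves.LFunctionPrimeCoeff
import Literature.NumberTheory.EllipticCurves.GeomPointsGaloisModule
import Literature.NumberTheory.Automorphic.BCDTModularity
import Literature.NumberTheory.GaloisRepresentations.DecompositionGroupOfCompletion
import Literature.Computability.AlgebraicComplexity.SchemeSymmetryGroupOrderF2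
import HarnessLib

/-!
# Schur at `2` on the habitat: an additive endomorphism of `W[2]` commuting with the decomposition group at `2` is `0` or the identity
# (from Serre 1972 Prop. 12: the decomposition group maps ONTO `GL₂(𝔽₂)`) — the local input of the condition at `2` of
# `stub_transport` v2 (crux (R≥)ᵖ, line «bt26-lambda»)

Route `ResidualThetaTransportAtTwo` (RTT), crux (R≥)ᵖ `ResidualThetaCountLowerPureAtTwo` (stmt-BirchSwinnertonDyer-26074); seat
`prover-bsd-wall-rtt-p2` g12 (`--supports`, closes nothing). HONEST FRAMING: THEOREMS ONLY (no definition, no named fact, no instance,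
no `sorry`); CONDITIONAL on the route's print binder `SerreSupersingularDecompositionImageInput` (item 27793) =
`Literature.NumberTheory.EllipticCurves.serre1972_supersingular_decompositionSubgroup_image`, taken as a hypothesis; BSD is not
proved by any of this.

WHY. In `stub_transport` v2 the `g`-side condition at `2` is read through `Θ ∘ j : ((W[2^∞])[2])^f → W[2^∞]^n`, an additive map
equivariant for the decomposition group `D₂` (local universality datum `Θ`, residual isomorphism `j`). To compare it with the
`W`-side condition coordinatewise one needs `Θ ∘ j` to be an `𝔽₂`-MATRIX of inclusions, i.e. `End_{D₂}(W[2]) = 𝔽₂`. On the habitat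
(`W` good supersingular at `2`, `a₂ = 0`) Serre's Prop. 12 gives `|ρ̄_{W,2}(D₂)| = 2(2² − 1) = 6 = |GL₂(𝔽₂)|`, so `D₂ ↠ GL₂(𝔽₂)` and an
endomorphism commuting with `D₂` commutes with `GL₂(𝔽₂)`, hence is scalar.

WHAT.
* `comm_GL_two_imp`, `swap_mul_swap`, `transvection_mul_transvection` — in `M₂(𝔽₂)`: a matrix commuting with `!![0,1;1,0]` and `!![1,1;0,1]` is `0` or `1` (`decide`).
* `#GL₂(𝔽₂) = 6` is the tree's `Literature.Computability.AlgebraicComplexity.card_GL_fin_two_zmod_two` (reused).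
* **`decomp_equivariant_addMonoidHom_eq_zero_or_eq_id`** — for `W` on the habitat, `v ∣ 2`, and an additive `u : W[2] → W[2]`
  commuting with every `absGaloisRestrict ℚ ℚ_v δ`: `u = 0` or `u = id` (granted Serre's fact).

References: [SerreInventiones1972] §1.11 Prop. 12, §2.2; [SilvermanAEC2009] III.§7.
-/

set_option autoImplicit false
-- the Theorems namespace of this sub repeats the summit name by design (D-0017 nested layout)
set_option linter.dupNamespace false

noncomputable section

open scoped MatrixGroups
open Matrix WeierstrassCurve NumberField Field IsDedekindDomain Literature Literature.NumberTheory.EllipticCurves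
  Literature.NumberTheory.GaloisRepresentations Literature.NumberTheory.EllipticCurves.Rank1Residual Rat.HeightOneSpectrum

namespace Summit.BirchSwinnertonDyer.BirchSwinnertonDyer.Theorems.ThetaTransport

/-- In `M₂(𝔽₂)`: a matrix commuting with the two generators `!![0,1;1,0]`, `!![1,1;0,1]` of `GL₂(𝔽₂)` is `0` or `1`. [folklore] -/
theorem comm_GL_two_imp (U : Matrix (Fin 2) (Fin 2) (ZMod 2)) (h1 : U * !![0, 1; 1, 0] = !![0, 1; 1, 0] * U)
    (h2 : U * !![1, 1; 0, 1] = !![1, 1; 0, 1] * U) : U = 0 ∨ U = 1 := by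
  revert U; decide

/-- `!![0,1;1,0]² = 1` in `M₂(𝔽₂)`. [folklore] -/
theorem swap_mul_swap : (!![0, 1; 1, 0] : Matrix (Fin 2) (Fin 2) (ZMod 2)) * !![0, 1; 1, 0] = 1 := by decide

/-- `!![1,1;0,1]² = 1` in `M₂(𝔽₂)`. [folklore] -/
theorem transvection_mul_transvection : (!![1, 1; 0, 1] : Matrix (Fin 2) (Fin 2) (ZMod 2)) * !![1, 1; 0, 1] = 1 := by decide

variable (W : WeierstrassCurve ℚ) [W.IsElliptic] [W.IsGloballyMinimal]

/-- **Schur at `2` on the habitat (granted Serre 1972 Prop. 12).** For `W/ℚ` globally minimal with good supersingular reduction at `2`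
and `a₂(W) = 0`, a place `v ∣ 2`, and an additive endomorphism `u` of `W[2] = E(ℚ̄)[2]` commuting with the action of every element of
the decomposition group `absGaloisRestrict ℚ ℚ_v (Γ_{ℚ_v})`: `u = 0` or `u = id`. Proof: in a frame `e : W[2] ≅ 𝔽₂²` carrying
`ρ̄ : Γ_ℚ →ₜ* GL₂(𝔽₂)` (`exists_isTorsionGaloisRep`), Serre's fact at the prime `𝔓₀ = adicCompletionPrime ℚ v` gives
`|ρ̄(D_{𝔓₀})| = 6`, so `ρ̄(D_{𝔓₀}) = GL₂(𝔽₂)`, `D_{𝔓₀}` is the range of `absGaloisRestrict` (Neukirch II (9.6)), and the matrix of `u`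
commutes with all of `GL₂(𝔽₂)`. [cite: SerreInventiones1972, §1.11 Prop. 12 (c),(d); §2.2] [cite: NeukirchANT1999, Ch. II §9 Prop. (9.6)] -/
theorem decomp_equivariant_addMonoidHom_eq_zero_or_eq_id (hSe : serre1972_supersingular_decompositionSubgroup_image)
    (hss : GoodSS W 2) (ha2 : W.frobeniusTrace 2 = 0) (v : HeightOneSpectrum (𝓞 ℚ)) (hv : ((2 : ℕ) : 𝓞 ℚ) ∈ v.asIdeal)
    (u : geomTorsion W 2 →+ geomTorsion W 2)
    (hu : ∀ (δ : absoluteGaloisGroup (v.adicCompletion ℚ)) (P : geomTorsion W 2),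
      u (absGaloisRestrict ℚ (v.adicCompletion ℚ) δ • P) = absGaloisRestrict ℚ (v.adicCompletion ℚ) δ • u P) :
    (∀ P, u P = 0) ∨ (∀ P, u P = P) := by
  classical
  haveI : Fact (Nat.Prime 2) := ⟨Nat.prime_two⟩
  haveI : NeZero ((2 : ℕ) : ℚ) := ⟨by norm_num⟩
  -- a continuous frame of `W[2]`
  obtain ⟨ρ, e, he⟩ := exists_isTorsionGaloisRep W 2
  -- Serre at the prime `𝔓₀` of the chosen embedding
  have hv2 : (primesEquiv v : ℕ) = 2 := primesEquiv_eq_of_natCast_mem v Nat.prime_two hv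
  have hgood : W.HasGoodReductionAt v := (hasGoodReductionAtPrime_primesEquiv_iff_holds W v 2 hv2).mp hss.1
  have hdvd : ((2 : ℕ) : ℤ) ∣ W.frobeniusTraceAt v := by
    rw [frobeniusTraceAt_eq_frobeniusTrace, hv2, ha2]; exact dvd_zero _
  obtain ⟨-, -, hcard⟩ := hSe W 2 v hv hgood hdvd ρ ⟨e, he⟩ (adicCompletionPrime ℚ v) (adicCompletionPrime_mem_primesAbove ℚ v)
  -- `ρ̄(D_{𝔓₀}) = GL₂(𝔽₂)`
  have htop : ((adicCompletionPrime ℚ v).decompositionSubgroup (absoluteGaloisGroup ℚ)).map ρ.toMonoidHom = ⊤ := by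
    apply Subgroup.eq_top_of_card_eq
    rw [hcard, Literature.Computability.AlgebraicComplexity.card_GL_fin_two_zmod_two]
    norm_num
  have hsurj : ∀ g : GL (Fin 2) (ZMod 2), ∃ δ : absoluteGaloisGroup (v.adicCompletion ℚ),
      ρ (absGaloisRestrict ℚ (v.adicCompletion ℚ) δ) = g := by
    intro g
    have hg : g ∈ ((adicCompletionPrime ℚ v).decompositionSubgroup (absoluteGaloisGroup ℚ)).map ρ.toMonoidHom := by
      rw [htop]; exact Subgroup.mem_top g
    obtain ⟨σ, hσ, rfl⟩ := hg
    rw [decompositionSubgroup_adicCompletionPrime_eq_range] at hσ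
    obtain ⟨δ, rfl⟩ := hσ
    exact ⟨δ, rfl⟩
  -- the matrix of `u` in the frame `e`
  let eₗ : geomTorsion W 2 →+ (Fin 2 → ZMod 2) := e.toAddMonoidHom
  let L : (Fin 2 → ZMod 2) →ₗ[ZMod 2] (Fin 2 → ZMod 2) :=
    ((e.toAddMonoidHom.comp u).comp e.symm.toAddMonoidHom).toZModLinearMap 2
  have hL : ∀ w, L w = e (u (e.symm w)) := fun _ ↦ rfl
  set U : Matrix (Fin 2) (Fin 2) (ZMod 2) := LinearMap.toMatrix' L with hUdef
  have hU : ∀ P, e (u P) = U *ᵥ e P := fun P ↦ by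
    rw [hUdef, ← Matrix.toLin'_apply, Matrix.toLin'_toMatrix', hL, e.symm_apply_apply]
  -- `U` commutes with every `g ∈ GL₂(𝔽₂)`
  have hcomm : ∀ g : GL (Fin 2) (ZMod 2), U * (g : Matrix (Fin 2) (Fin 2) (ZMod 2)) = (g : Matrix (Fin 2) (Fin 2) (ZMod 2)) * U := by
    intro g
    obtain ⟨δ, hδ⟩ := hsurj g
    refine Matrix.toLin'.injective (LinearMap.ext fun w ↦ ?_)
    obtain ⟨P, rfl⟩ := e.surjective w
    rw [Matrix.toLin'_apply, Matrix.toLin'_apply, ← Matrix.mulVec_mulVec, ← Matrix.mulVec_mulVec, ← hδ, ← he, ← hU, ← hU,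
      ← he, hu]
  -- the two generators as units
  let g1 : GL (Fin 2) (ZMod 2) := ⟨!![0, 1; 1, 0], !![0, 1; 1, 0], swap_mul_swap, swap_mul_swap⟩
  let g2 : GL (Fin 2) (ZMod 2) :=
    ⟨!![1, 1; 0, 1], !![1, 1; 0, 1], transvection_mul_transvection, transvection_mul_transvection⟩
  rcases comm_GL_two_imp U (hcomm g1) (hcomm g2) with h0 | h1
  · left
    intro P
    apply e.injective
    rw [hU, h0, Matrix.zero_mulVec, map_zero]
  · right
    intro P
    apply e.injective
    rw [hU, h1, Matrix.one_mulVec]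

end Summit.BirchSwinnertonDyer.BirchSwinnertonDyer.Theorems.ThetaTransport

end
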